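import Literature.Analysis.FluidPDE.DongZhangTimeAnalyticity
import Literature.Analysis.FluidPDE.OseenSchemePicard
import Literature.Analysis.FluidPDE.NSBoundedMildSmoothing
import Literature.Analysis.Complex.CauchyTaylorBall
import HarnessLib

/-!
# Dong–Zhang 2020, Thm. 2 of §3 holds: time-derivative bounds for bounded mild solutions

Analysis/FluidPDE proofs file (everything proved; no definitions, no named facts): the discharge
`DongZhang2020_timeDerivative_bounds_boundedMild_holds` of the named fact
`Literature.Analysis.FluidPDE.DongZhang2020_timeDerivative_bounds_boundedMild`
(`DongZhangTimeAnalyticity.lean`; H. Dong, Q. S. Zhang, *Time analyticity for the heat equation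
and Navier–Stokes equations*, J. Funct. Anal. 279 (2020) 108563 = arXiv:1907.01687, §3 Thm. 2
(Thm. 3.1 of the journal version), arXiv p. 7: a bounded mild solution `u` of the Navier–Stokes
equations on `[0,1] × ℝᵈ` satisfies `sup_t tⁿ ‖∂ₜⁿ u(t,·)‖_∞ ≤ N^{n+1} nⁿ` for all `n ≥ 1`).

## The printed proof and the proof given here

The printed proof (arXiv pp. 7–8) is a real-variable induction on `n` (Prop. 1:
`sup_t ‖∂ₜⁿ(tⁿu)‖_∞ ≤ N^{n-1/2} n^{n-2/3}`, from the `L¹` bounds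
`‖∂ₜᵏ(tᵏΓ)‖₁, ‖∂ₜᵏ(tᵏ∇E)‖₁ ≤ C₁^{k+1} k^{k-2/3}` of the heat and Stokes kernels, the Stirling sum
of Lemma 1 and Gronwall's inequality), followed by the binomial recursion
`∂ₜⁿ(tᵏu) = n∂ₜⁿ⁻¹(tᵏ⁻¹u) + t∂ₜⁿ(tᵏ⁻¹u)`. The tree already contains a complete complex-time
theory of the same integral equation — Lemarié-Rieusset's complexified Oseen scheme
(`OseenSchemeComplex*.lean`, `OseenSchemePicard.lean`: for a bounded measurable datum `b`,
`‖b‖ ≤ M`, and a window `T₀` with `8 C_B √T₀ K_G M ≤ 1`, the Picard limit `U = picardLimitC 1 b`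
is holomorphic and bounded by `2K_G M` on the root-time sector domain `schemeDomain 1 T₀`, and its
real restriction `picardLimitReal 1 b` solves `v(t) = e^{tΔ}b - B¹₀(v,v)(t)` pointwise on
`(0, T₀)`), together with the uniqueness of bounded solutions of the Oseen integral equation
(`oseenMild_bounded_unique`, `OseenMildUniqueness.lean`) and Cauchy's inequalities
(`Literature.Analysis.Complex.norm_iteratedDeriv_le_of_forall_mem_ball`). So the theorem is
proved here by the (classical, shorter) complex-variable road instead of the printed induction:

1. **restart**: for `t₀ ∈ (0,1)` put `δ = min(t₀, T₀/2)`, `s = t₀ - δ ≥ 0`, datum `b = u(s)`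
   (bounded by `C₂ ≤ M = C₂ + 1`, measurable), `T₀ = (8 C_B K_G M)⁻²`;
2. **identification**: `v(t) = picardLimitReal 1 b (t - s)` and `u` both solve
   `w(t) = e^{(t-s)Δ}b - B¹_s(w,w)(t)` pointwise on `(s, min(1, s + T₀))` (the hypothesis of the
   fact is literally this identity with `oseenDuhamel 1 s u u` unfolded; for `v` it is
   `picardLimitReal_eq` and the time translation `oseenDuhamel_translate`), both are bounded and
   jointly measurable, hence `u(t) = v(t)` a.e. (`oseenMild_bounded_unique`) and then everywhere
   (both slices are continuous);
3. **holomorphic extension in time**: `G(w) = U((w - s)^{1/2}, 0)(x)` is holomorphic on the disc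
   `|w - t₀| < δ/2` (the principal root of `w - s` lies in the sector `|Im m| < Re m/2`,
   `|m|² < T₀` — an elementary check, `re_pos_and_abs_im_lt_of_sector`) and bounded by `2K_G M`
   there; on a real neighbourhood of `t₀` it equals `cx (u(t, x))` (`complexify_picardLimitReal`
   and step 2);
4. **Cauchy**: `‖G⁽ⁿ⁾(t₀)‖ ≤ n! (2K_G M)/(δ/4)ⁿ`; restriction to the real axis commutes with
   iterated derivatives (`iteratedDeriv_comp_ofReal_eq_vec`, the vector-valued form of the tree's
   scalar lemma) and `cx` is a real linear isometry, so `‖∂ₜⁿu(t₀,x)‖ = ‖G⁽ⁿ⁾(t₀)‖` (here the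
   smoothness hypothesis of the fact is used, through
   `LinearIsometry.norm_iteratedFDerivWithin_comp_left` on `(0,1)`);
5. **arithmetic**: `t₀ⁿ (4/δ)ⁿ ≤ (4 + 8/T₀)ⁿ` and `n! ≤ nⁿ`, whence the bound with
   `N = max(4 + 8/T₀, 2K_G M + 1)`, which depends only on `d` and `C₂`, as printed.

As in the printed theorem, the divergence-free hypothesis and `d ≥ 2` are not used by the
argument (they only interpret the integral equation as the Navier–Stokes equations).

## Mathlib / tree search

Tree: `picardLimitC`, `picardLimitReal`, `picardLimitReal_eq`, `complexify_picardLimitReal`,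
`norm_picardLimitC_le`, `differentiableOn_picardLimitC`, `continuousOn_uncurry_picardLimitReal`,
`freeConstC_pos`, `duhamelConstC_pos` (`OseenSchemePicard.lean`); `schemeDomain`,
`isOpen_schemeDomain` (`OseenSchemeComplex.lean`); `oseenMild_bounded_unique`
(`OseenMildUniqueness.lean`); `oseenDuhamel_translate` (`NSBoundedMildSmoothing.lean`);
`oseenDuhamel_apply`, `oseenKernel`, `oseenWeightA/B` (`NSBoundedMildOseen.lean`,
`KochTataru.lean`); `heatFlow_of_pos` (`MildSolution.lean`);
`Literature.Analysis.Complex.norm_iteratedDeriv_le_of_forall_mem_ball` (`CauchyTaylorBall.lean`);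
the scalar template `iteratedDeriv_comp_ofReal_eq` (`HalfIsolatedZeroDerivBounds.lean`, not
imported). Mathlib: `HasFDerivAt.restrictScalars`, `DifferentiableOn.deriv`,
`Filter.EventuallyEq.iteratedDeriv_eq`, `iteratedDerivWithin_of_isOpen`,
`LinearIsometry.norm_iteratedFDerivWithin_comp_left`, `Complex.cpow_inv_two_re`,
`Complex.cpow_nat_inv_pow`, `Complex.ofReal_cpow`, `DifferentiableAt.cpow_const`,
`Continuous.ae_eq_iff_eq`, `Nat.factorial_le_pow`.

## References

* H. Dong, Q. S. Zhang, *Time analyticity for the heat equation and Navier–Stokes equations*,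
  J. Funct. Anal. 279 (2020), no. 4, 108563, doi:10.1016/j.jfa.2020.108563 = arXiv:1907.01687,
  §3 Thm. 2 (statement p. 7, proof pp. 7–8). [DongZhang2020]
* P. G. Lemarié-Rieusset, *The Navier–Stokes Problem in the 21st Century*, CRC Press 2016,
  Thm. 9.12, proof pp. 260–263 (the complexified Oseen scheme used here). [LemarieRieusset2016]
-/

noncomputable section

open MeasureTheory Set Function Filter Metric
open _root_.Topology
open scoped Nat

namespace Literature.Analysis.FluidPDE

open Literature.Analysis.FunctionSpaces.EuclideanSpace (complexify complexify_apply norm_complexify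
  complexify_injective)
open UnboundedOperators (heatExtension heatKernel)

/-! ### Restriction of holomorphic vector-valued maps to the real axis -/

section RealAxis

variable {F : Type*} [NormedAddCommGroup F] [NormedSpace ℂ F] [NormedSpace ℝ F]
  [IsScalarTower ℝ ℂ F]

/-- Vector-valued form of Mathlib's `HasDerivAt.comp_ofReal`: a complex derivative of `e` at a
real point is a real derivative of `y ↦ e y` there. [folklore] -/
theorem hasDerivAt_comp_ofReal_vec {e : ℂ → F} {e' : F} {z : ℝ} (hf : HasDerivAt e e' (z : ℂ)) :
    HasDerivAt (fun y : ℝ => e (y : ℂ)) e' z := by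
  have h := ((hf.hasFDerivAt.restrictScalars ℝ).comp z Complex.ofRealCLM.hasFDerivAt).hasDerivAt
  have h' : HasDerivAt (e ∘ Complex.ofReal) e' z := h.congr_deriv (by simp)
  exact h'

variable [CompleteSpace F]

omit [NormedSpace ℝ F] [IsScalarTower ℝ ℂ F] in
/-- The iterated derivatives of a map holomorphic on an open set are holomorphic there.
[folklore] -/
theorem differentiableOn_iteratedDeriv_of_isOpen_vec {e : ℂ → F} {V : Set ℂ} (hV : IsOpen V)
    (he : DifferentiableOn ℂ e V) (m : ℕ) : DifferentiableOn ℂ (iteratedDeriv m e) V := by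
  induction m with
  | zero => simpa using he
  | succ m ih => rw [iteratedDeriv_succ]; exact ih.deriv hV

/-- **Restriction to the real axis commutes with iterated derivatives** (vector-valued): for `e`
holomorphic on an open `V ⊆ ℂ` and a real `x ∈ V`, the `m`-th real derivative of `y ↦ e(y)` at
`x` is `e^{(m)}(x)`. [folklore] -/
theorem iteratedDeriv_comp_ofReal_eq_vec {e : ℂ → F} {V : Set ℂ} (hV : IsOpen V)
    (he : DifferentiableOn ℂ e V) (m : ℕ) {x : ℝ} (hx : (x : ℂ) ∈ V) :
    iteratedDeriv m (fun y : ℝ => e y) x = iteratedDeriv m e x := by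
  induction m generalizing x with
  | zero => simp
  | succ m ih =>
    have hdiff := differentiableOn_iteratedDeriv_of_isOpen_vec hV he m
    rw [iteratedDeriv_succ, iteratedDeriv_succ]
    have hev : (iteratedDeriv m fun y : ℝ => e y) =ᶠ[𝓝 x] fun y : ℝ => iteratedDeriv m e y := by
      have : ∀ᶠ y : ℝ in 𝓝 x, (y : ℂ) ∈ V :=
        Complex.continuous_ofReal.continuousAt.preimage_mem_nhds (hV.mem_nhds hx)
      filter_upwards [this] with y hy using ih hy
    rw [hev.deriv_eq]
    have h2 : HasDerivAt (iteratedDeriv m e) (deriv (iteratedDeriv m e) x) x :=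
      ((hdiff _ hx).differentiableAt (hV.mem_nhds hx)).hasDerivAt
    exact (hasDerivAt_comp_ofReal_vec h2).deriv

end RealAxis

/-! ### The principal square root of a point of the sector `3|z| < 5 Re z` -/

/-- If `3|z| < 5 Re z` then the principal root `m = z^{1/2}` lies in the root-time sector of the
complexified Oseen scheme: `0 < Re m` and `|Im m| < Re m / 2`. [folklore] -/
theorem re_pos_and_abs_im_lt_of_sector {z : ℂ} (hz : 3 * ‖z‖ < 5 * z.re) :
    0 < (z ^ (2⁻¹ : ℂ)).re ∧ |(z ^ (2⁻¹ : ℂ)).im| < (z ^ (2⁻¹ : ℂ)).re / 2 := by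
  have hre0 : 0 ≤ (z ^ (2⁻¹ : ℂ)).re := by
    rw [Complex.cpow_inv_two_re]; exact Real.sqrt_nonneg _
  have hm2 : (z ^ (2⁻¹ : ℂ)) ^ 2 = z := by
    have h := Complex.cpow_nat_inv_pow z (n := 2) two_ne_zero
    exact_mod_cast h
  set m : ℂ := z ^ (2⁻¹ : ℂ) with hm
  have hzre : z.re = m.re ^ 2 - m.im ^ 2 := by
    rw [← hm2, sq, Complex.mul_re]; ring
  have hznorm : ‖z‖ = m.re ^ 2 + m.im ^ 2 := by
    rw [← hm2, norm_pow, Complex.sq_norm, Complex.normSq_apply]; ring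
  rw [hzre, hznorm] at hz
  have hb : (2 * |m.im|) ^ 2 < m.re ^ 2 := by nlinarith [sq_abs m.im]
  have ha : 0 < m.re := by
    rcases hre0.lt_or_eq with h | h
    · exact h
    · rw [← h] at hb; nlinarith [sq_nonneg (2 * |m.im|)]
  have h2 : 2 * |m.im| < m.re := lt_of_pow_lt_pow_left₀ 2 ha.le hb
  exact ⟨ha, by linarith⟩

/-! ### The discharge -/

/-- **Dong–Zhang 2020, §3 Thm. 2 holds** (`DongZhang2020_timeDerivative_bounds_boundedMild`):
a bounded, jointly measurable, smooth-on-the-open-slab solution of the Oseen integral equation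
`u(t) = e^{(t-s)Δ}u(s) - B¹_s(u,u)(t)` (`0 ≤ s < t ≤ 1`) satisfies
`tⁿ ‖∂ₜⁿ u(t,x)‖ ≤ N^{n+1} nⁿ` for all `n ≥ 1`, `t ∈ (0,1)`, `x`, with `N` depending only on `d`
and the bound `C₂`. Proof by complex time: restart shortly before `t`, identify `u` with the real
restriction of the holomorphic Picard limit of the complexified Oseen scheme (uniqueness of
bounded solutions), and apply Cauchy's inequalities on a disc of radius `∼ min(t, C₂⁻²)`; see the
module docstring for the comparison with the printed real-variable induction. [cite: DongZhang2020, §3 Thm. 2 (arXiv:1907.01687 p. 7; JFA 279 (2020) 108563, Thm. 3.1); proof via LemarieRieusset2016 Thm. 9.12 (pp. 260–263)] -/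
theorem DongZhang2020_timeDerivative_bounds_boundedMild_holds :
    DongZhang2020_timeDerivative_bounds_boundedMild := by
  intro d u C₂ _hd hmeas _hdiv hbd hmild hsmooth
  -- the constants of the complexified Oseen scheme in dimension `d`
  set K : ℝ := freeConstC (Fin d) with hK_def
  set CB : ℝ := duhamelConstC (Fin d) with hCB_def
  have hK : 0 < K := freeConstC_pos _
  have hCB : 0 < CB := duhamelConstC_pos _
  have hC₂ : 0 ≤ C₂ := (norm_nonneg _).trans (hbd 0 ⟨le_rfl, zero_le_one⟩ 0)
  set M : ℝ := C₂ + 1 with hM_def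
  have hM : 0 < M := by linarith
  have hKM : 0 ≤ 2 * K * M := mul_nonneg (mul_nonneg two_pos.le hK.le) hM.le
  -- the window `T₀ = (8 C_B K_G M)⁻²`, for which the smallness condition is an equality
  have h8 : 0 < 8 * CB * K * M := mul_pos (mul_pos (mul_pos (by norm_num) hCB) hK) hM
  set T₀ : ℝ := ((8 * CB * K * M)⁻¹) ^ 2 with hT₀_def
  have hT₀ : 0 < T₀ := by rw [hT₀_def]; exact pow_pos (inv_pos.2 h8) 2
  have hsqrtT₀ : Real.sqrt T₀ = (8 * CB * K * M)⁻¹ := by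
    rw [hT₀_def, Real.sqrt_sq (inv_pos.2 h8).le]
  have hsmall : 8 * (duhamelConstC (Fin d) * (Real.sqrt (1 * T₀) / 1)) * freeConstC (Fin d) * M ≤ 1 := by
    rw [one_mul, div_one, hsqrtT₀, ← hCB_def, ← hK_def,
      show 8 * (CB * (8 * CB * K * M)⁻¹) * K * M = (8 * CB * K * M) * (8 * CB * K * M)⁻¹ by ring,
      mul_inv_cancel₀ h8.ne']
  -- the constant `N`
  set A : ℝ := 4 + 8 / T₀ with hA_def
  have hA4 : 4 ≤ A := by
    have : 0 ≤ 8 / T₀ := div_nonneg (by norm_num) hT₀.le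
    linarith
  set N : ℝ := max A (2 * K * M + 1) with hN_def
  have hN1 : 1 ≤ N := le_trans (by linarith) (le_max_left _ _)
  refine ⟨N, hN1, fun n _hn t₀ ht₀ x => ?_⟩
  /- Step 1: the restart time `s = t₀ - δ`, `δ = min(t₀, T₀/2)`; the datum is `u s`. -/
  set δ : ℝ := min t₀ (T₀ / 2) with hδ_def
  have hδ0 : 0 < δ := lt_min ht₀.1 (half_pos hT₀)
  have hδt : δ ≤ t₀ := min_le_left _ _
  have hδT : δ ≤ T₀ / 2 := min_le_right _ _
  set s : ℝ := t₀ - δ with hs_def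
  have hs0 : 0 ≤ s := by linarith
  have hst₀ : s < t₀ := by linarith
  have hs1 : s ≤ 1 := by linarith [ht₀.2]
  have hbm : AEStronglyMeasurable (u s) volume :=
    (hmeas.comp measurable_prodMk_left).aestronglyMeasurable
  have hbM : ∀ y, ‖u s y‖ ≤ M := fun y => (hbd s ⟨hs0, hs1⟩ y).trans (by linarith)
  /- Step 2: the local solution `(t, y) ↦ picardLimitReal 1 (u s) (t - s) y` and its
  identification with `u` on `(s, T')`, `T' = min(1, s + T₀)`. -/
  have hv_eq : ∀ t ∈ Ioo s (s + T₀), ∀ y,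
      picardLimitReal 1 (u s) (t - s) y = heatExtension (u s) (t - s) y -
        oseenDuhamel 1 s (fun τ z => picardLimitReal 1 (u s) (τ - s) z)
          (fun τ z => picardLimitReal 1 (u s) (τ - s) z) t y := by
    intro t ht y
    have hts : t - s ∈ Ioo 0 T₀ := ⟨by linarith [ht.1], by linarith [ht.2]⟩
    have h := picardLimitReal_eq one_pos hbm hM.le hbM hsmall hts y
    have hD : oseenDuhamel 1 0 (picardLimitReal 1 (u s)) (picardLimitReal 1 (u s)) (t - s) y =
        oseenDuhamel 1 s (fun τ z => picardLimitReal 1 (u s) (τ - s) z)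
          (fun τ z => picardLimitReal 1 (u s) (τ - s) z) t y := by
      have h2 := oseenDuhamel_translate 1 0 s (fun τ z => picardLimitReal 1 (u s) (τ - s) z)
        (fun τ z => picardLimitReal 1 (u s) (τ - s) z) (t - s) y
      simp only [add_sub_cancel_right, zero_add, sub_add_cancel] at h2
      exact h2
    rw [one_mul, hD] at h
    exact h
  have hu_eq : ∀ t, s < t → t ≤ 1 → ∀ y,
      u t y = heatExtension (u s) (t - s) y - oseenDuhamel 1 s u u t y := by
    intro t hst ht1 y
    have h := hmild s t hs0 hst ht1 y
    rw [heatFlow_of_pos _ (sub_pos.2 hst)] at h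
    rw [h, oseenDuhamel_apply]
    simp only [oseenKernel, oseenWeightA, oseenWeightB, one_mul]
  have htr : Continuous fun q : ℝ × EuclideanSpace ℝ (Fin d) => (q.1 - s, q.2) := by fun_prop
  have hmaps : MapsTo (fun q : ℝ × EuclideanSpace ℝ (Fin d) => (q.1 - s, q.2))
      (Ioo s (s + T₀) ×ˢ univ) (Ioo 0 T₀ ×ˢ univ) := by
    intro q hq
    obtain ⟨hq1, -⟩ := mem_prod.1 hq
    exact mk_mem_prod ⟨by linarith [hq1.1], by linarith [hq1.2]⟩ (mem_univ _)
  have hvcont : ContinuousOn (uncurry (picardLimitReal 1 (u s)) ∘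
      fun q : ℝ × EuclideanSpace ℝ (Fin d) => (q.1 - s, q.2)) (Ioo s (s + T₀) ×ˢ univ) :=
    (continuousOn_uncurry_picardLimitReal one_pos hbm hM.le hbM hsmall).comp htr.continuousOn hmaps
  set T' : ℝ := min 1 (s + T₀) with hT'_def
  have hT'1 : T' ≤ 1 := min_le_left _ _
  have hT'2 : T' ≤ s + T₀ := min_le_right _ _
  have ht₀T' : t₀ < T' := lt_min ht₀.2 (by linarith)
  have hvm : AEStronglyMeasurable (uncurry fun t y => picardLimitReal 1 (u s) (t - s) y)
      ((volume : Measure (ℝ × EuclideanSpace ℝ (Fin d))).restrict (Ioo s T' ×ˢ univ)) :=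
    (hvcont.mono (prod_mono (Ioo_subset_Ioo_right hT'2) Subset.rfl)).aestronglyMeasurable
      (measurableSet_Ioo.prod MeasurableSet.univ)
  have huniq : ∀ t ∈ Ioo s T', u t =ᵐ[volume] fun y => picardLimitReal 1 (u s) (t - s) y := by
    refine oseenMild_bounded_unique (ν := 1) (s := s) (T := T') (M := 2 * K * M + M) (u := u)
      (v := fun t y => picardLimitReal 1 (u s) (t - s) y)
      (U := fun t y => heatExtension (u s) (t - s) y) one_pos (add_nonneg hKM hM.le)
      hmeas.aestronglyMeasurable.restrict hvm
      (fun τ hτ y => ?_) (fun τ hτ y => ?_) (fun t ht => ?_) (fun t ht => ?_)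
    · have h1 := hbd τ ⟨hs0.trans hτ.1.le, hτ.2.le.trans hT'1⟩ y
      linarith
    · have hτs : τ - s ∈ Ioo 0 T₀ := ⟨by linarith [hτ.1], by linarith [hτ.2]⟩
      have h1 := norm_picardLimitReal_le one_pos hbm hM.le hbM hsmall hτs y
      linarith
    · exact Eventually.of_forall (hu_eq t ht.1 (ht.2.le.trans hT'1))
    · exact Eventually.of_forall (hv_eq t ⟨ht.1, ht.2.trans_le hT'2⟩)
  have hueq : ∀ t ∈ Ioo s T', u t = fun y => picardLimitReal 1 (u s) (t - s) y := by
    intro t ht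
    have ht01 : t ∈ Ioo (0 : ℝ) 1 := ⟨hs0.trans_lt ht.1, ht.2.trans_le hT'1⟩
    have hcu : Continuous (u t) :=
      hsmooth.continuousOn.comp_continuous (f := fun y => (t, y)) (by fun_prop)
        fun y => mk_mem_prod ht01 (mem_univ _)
    have hty : Continuous fun y : EuclideanSpace ℝ (Fin d) => (t - s, y) := by fun_prop
    have hcv' := (continuousOn_uncurry_picardLimitReal one_pos hbm hM.le hbM hsmall).comp_continuous
      hty fun y => mk_mem_prod (⟨by linarith [ht.1], by linarith [ht.2]⟩ : t - s ∈ Ioo 0 T₀)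
        (mem_univ _)
    have hcv : Continuous fun y => picardLimitReal 1 (u s) (t - s) y := hcv'
    exact (Continuous.ae_eq_iff_eq volume hcu hcv).1 (huniq t ht)
  /- Step 3: the holomorphic extension `G(w) = U((w - s)^{1/2}, 0)(x)` on the disc
  `|w - t₀| < r = δ/2`. -/
  set r : ℝ := δ / 2 with hr_def
  have hr0 : 0 < r := half_pos hδ0
  have hball : ∀ w ∈ ball (t₀ : ℂ) r,
      δ / 2 < (w - s).re ∧ 3 * ‖w - (s : ℂ)‖ < 5 * (w - s).re ∧ ‖w - (s : ℂ)‖ < 3 * δ / 2 := by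
    intro w hw
    rw [mem_ball, dist_eq_norm] at hw
    have hz : w - (s : ℂ) = (w - t₀) + (δ : ℂ) := by
      rw [hs_def, Complex.ofReal_sub]; ring
    have hre : δ / 2 < (w - s).re := by
      rw [hz, Complex.add_re, Complex.ofReal_re]
      have := (abs_le.1 (Complex.abs_re_le_norm (w - t₀))).1
      linarith
    have him : |(w - s).im| < δ / 2 := by
      rw [hz, Complex.add_im, Complex.ofReal_im, add_zero]
      exact (Complex.abs_im_le_norm _).trans_lt hw
    have hnorm : ‖w - (s : ℂ)‖ < 3 * δ / 2 := by
      rw [hz]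
      calc ‖w - t₀ + (δ : ℂ)‖ ≤ ‖w - (t₀ : ℂ)‖ + ‖(δ : ℂ)‖ := norm_add_le _ _
        _ < r + δ := by
            rw [Complex.norm_real, Real.norm_of_nonneg hδ0.le]; linarith
        _ = 3 * δ / 2 := by rw [hr_def]; ring
    refine ⟨hre, ?_, hnorm⟩
    have h3 : ‖w - (s : ℂ)‖ ^ 2 = (w - s).re ^ 2 + (w - s).im ^ 2 := by
      rw [Complex.sq_norm, Complex.normSq_apply]; ring
    have h5 : |(w - (s : ℂ)).im| < (w - s).re := by linarith
    have h6 : |(w - (s : ℂ)).im| ^ 2 < (w - s).re ^ 2 :=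
      pow_lt_pow_left₀ h5 (abs_nonneg _) two_ne_zero
    rw [sq_abs] at h6
    have h4 : (3 * ‖w - (s : ℂ)‖) ^ 2 < (5 * (w - s).re) ^ 2 := by nlinarith
    exact lt_of_pow_lt_pow_left₀ 2 (by linarith) h4
  have hPmem : ∀ w ∈ ball (t₀ : ℂ) r,
      (((w - s) ^ (2⁻¹ : ℂ), 0) : ℂ × EuclideanSpace ℂ (Fin d)) ∈ schemeDomain 1 T₀ := by
    intro w hw
    obtain ⟨-, hsec, hnorm⟩ := hball w hw
    obtain ⟨hmre, hmim⟩ := re_pos_and_abs_im_lt_of_sector hsec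
    refine ⟨hmre, hmim, ?_, ?_⟩
    · show ‖(w - s) ^ (2⁻¹ : ℂ)‖ ^ 2 < 1 * T₀
      have hsq : ((w - s) ^ (2⁻¹ : ℂ)) ^ 2 = w - s := by
        have h := Complex.cpow_nat_inv_pow (w - s) (n := 2) two_ne_zero
        exact_mod_cast h
      rw [← norm_pow, hsq, one_mul]
      linarith
    · show ‖(0 : EuclideanSpace ℂ (Fin d))‖ < (Real.sqrt (1 * T₀))⁻¹
      rw [norm_zero, one_mul]
      exact inv_pos.2 (Real.sqrt_pos.2 hT₀)
  set G : ℂ → EuclideanSpace ℂ (Fin d) :=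
    fun w => picardLimitC 1 (u s) ((w - s) ^ (2⁻¹ : ℂ), 0) x with hG_def
  have hGdiff : DifferentiableOn ℂ G (ball (t₀ : ℂ) r) := by
    intro w hw
    have hPw := hPmem w hw
    have hslit : w - (s : ℂ) ∈ Complex.slitPlane :=
      Complex.mem_slitPlane_iff.2 (Or.inl (by linarith [(hball w hw).1]))
    have hPd : DifferentiableAt ℂ
        (fun w : ℂ => (((w - s) ^ (2⁻¹ : ℂ), 0) : ℂ × EuclideanSpace ℂ (Fin d))) w :=
      ((differentiableAt_id.sub_const (s : ℂ)).cpow_const hslit).prodMk (differentiableAt_const _)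
    have hUat : DifferentiableAt ℂ (fun p => picardLimitC 1 (u s) p x) ((w - s) ^ (2⁻¹ : ℂ), 0) :=
      (differentiableOn_picardLimitC one_pos hbm hM.le hbM hsmall x).differentiableAt
        ((isOpen_schemeDomain 1 T₀).mem_nhds hPw)
    exact (hUat.comp w hPd).differentiableWithinAt
  have hGbd : ∀ w ∈ ball (t₀ : ℂ) r, ‖G w‖ ≤ 2 * K * M := fun w hw =>
    norm_picardLimitC_le one_pos hbm hM.le hbM hsmall (hPmem w hw) x
  have hCauchy : ‖iteratedDeriv n G (t₀ : ℂ)‖ ≤ n ! * (2 * K * M) / (r / 2) ^ n :=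
    Literature.Analysis.Complex.norm_iteratedDeriv_le_of_forall_mem_ball hr0 hGdiff hGbd n
  /- Step 4: on a real neighbourhood of `t₀`, `G(t) = cx (u(t, x))`. -/
  have hGreal : ∀ t ∈ Ioo (t₀ - r) (min (t₀ + r) T'), G (t : ℂ) = complexify (u t x) := by
    intro t ht
    have ht1 : t < t₀ + r := ht.2.trans_le (min_le_left _ _)
    have ht2 : t < T' := ht.2.trans_le (min_le_right _ _)
    have hts : s < t := by linarith [ht.1]
    have htsT : t - s ∈ Ioo 0 T₀ := ⟨by linarith, by linarith⟩
    have hroot : ((t : ℂ) - (s : ℂ)) ^ (2⁻¹ : ℂ) = ((Real.sqrt (1 * (t - s)) : ℝ) : ℂ) := by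
      rw [← Complex.ofReal_sub, one_mul, Real.sqrt_eq_rpow,
        Complex.ofReal_cpow (by linarith : 0 ≤ t - s)]
      norm_num
    simp only [hG_def]
    rw [hroot, ← complexify_picardLimitReal one_pos hbm hM.le hbM hsmall htsT x, hueq t ⟨hts, ht2⟩]
  /- Step 5: derivatives. -/
  have hev : (fun t : ℝ => G (t : ℂ)) =ᶠ[𝓝 t₀] fun t => complexify (u t x) := by
    have hmem : Ioo (t₀ - r) (min (t₀ + r) T') ∈ 𝓝 t₀ :=
      Ioo_mem_nhds (by linarith) (lt_min (by linarith) ht₀T')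
    filter_upwards [hmem] with t ht using hGreal t ht
  have hD1 : iteratedDeriv n (fun t : ℝ => G (t : ℂ)) t₀ = iteratedDeriv n G (t₀ : ℂ) :=
    iteratedDeriv_comp_ofReal_eq_vec isOpen_ball hGdiff n (mem_ball_self hr0)
  have hcd : ContDiffOn ℝ (⊤ : ℕ∞) (fun t => u t x) (Ioo (0 : ℝ) 1) :=
    hsmooth.comp (contDiffOn_id.prodMk contDiffOn_const) fun t ht => mk_mem_prod ht (mem_univ _)
  have hD2 : ‖iteratedDeriv n (fun t => complexify (u t x)) t₀‖ =
      ‖iteratedDeriv n (fun t => u t x) t₀‖ := by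
    have hopen : IsOpen (Ioo (0 : ℝ) 1) := isOpen_Ioo
    rw [← iteratedDerivWithin_of_isOpen (n := n) (f := fun t => complexify (u t x)) hopen ht₀,
      ← iteratedDerivWithin_of_isOpen (n := n) (f := fun t => u t x) hopen ht₀,
      ← norm_iteratedFDerivWithin_eq_norm_iteratedDerivWithin,
      ← norm_iteratedFDerivWithin_eq_norm_iteratedDerivWithin]
    exact (complexify (ι := Fin d)).norm_iteratedFDerivWithin_comp_left
      (hcd.contDiffWithinAt ht₀) (uniqueDiffOn_Ioo 0 1) ht₀ (by exact_mod_cast le_top)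
  have hnorm : ‖iteratedDeriv n (fun t => u t x) t₀‖ ≤ n ! * (2 * K * M) / (r / 2) ^ n := by
    calc ‖iteratedDeriv n (fun t => u t x) t₀‖
        = ‖iteratedDeriv n (fun t => complexify (u t x)) t₀‖ := hD2.symm
      _ = ‖iteratedDeriv n (fun t : ℝ => G (t : ℂ)) t₀‖ := by rw [hev.iteratedDeriv_eq n]
      _ = ‖iteratedDeriv n G (t₀ : ℂ)‖ := by rw [hD1]
      _ ≤ _ := hCauchy
  /- Step 6: arithmetic. -/
  have hr2 : r / 2 = δ / 4 := by rw [hr_def]; ring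
  have hratio : 4 * t₀ / δ ≤ A := by
    rw [div_le_iff₀ hδ0]
    rcases le_total t₀ (T₀ / 2) with h | h
    · have hδeq : δ = t₀ := min_eq_left h
      rw [hδeq]
      nlinarith [hA4, ht₀.1.le]
    · have hδeq : δ = T₀ / 2 := min_eq_right h
      rw [hδeq, hA_def]
      have h' : (4 + 8 / T₀) * (T₀ / 2) = 2 * T₀ + 4 := by
        field_simp
        ring
      rw [h']
      linarith [ht₀.2]
  have hfac : (n ! : ℝ) ≤ (n : ℝ) ^ n := by exact_mod_cast Nat.factorial_le_pow n
  have hKMN : 2 * K * M ≤ N := le_trans (by linarith) (le_max_right _ _)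
  have hAN : A ≤ N := le_max_left _ _
  have hA0 : 0 ≤ A := by linarith
  have hq0 : 0 ≤ 4 * t₀ / δ := div_nonneg (by linarith [ht₀.1]) hδ0.le
  have hnN : 0 ≤ (n : ℝ) ^ n * N := mul_nonneg (by positivity) (by linarith)
  calc t₀ ^ n * ‖iteratedDeriv n (fun s => u s x) t₀‖
      ≤ t₀ ^ n * (n ! * (2 * K * M) / (r / 2) ^ n) :=
        mul_le_mul_of_nonneg_left hnorm (pow_nonneg ht₀.1.le n)
    _ = n ! * (2 * K * M) * (4 * t₀ / δ) ^ n := by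
        have hδn : δ ^ n ≠ 0 := pow_ne_zero n hδ0.ne'
        rw [hr2, div_pow, div_pow, mul_pow]
        field_simp
    _ ≤ (n : ℝ) ^ n * N * A ^ n :=
        mul_le_mul (mul_le_mul hfac hKMN hKM (by positivity)) (pow_le_pow_left₀ hq0 hratio n)
          (pow_nonneg hq0 n) hnN
    _ ≤ (n : ℝ) ^ n * N * N ^ n := mul_le_mul_of_nonneg_left (pow_le_pow_left₀ hA0 hAN n) hnN
    _ = N ^ (n + 1) * (n : ℝ) ^ n := by ring

end Literature.Analysis.FluidPDE

end
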